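import Literature.Probability.LatticeModels.ProdBernoulliIndependence
import Literature.Probability.Percolation.PercolationProofs
import Literature.Probability.Percolation.PercolationEvents
import HarnessLib

/-!
# The ISOLATION form of the three-point variance row, on EVERY finite weighted graph

Support file for crux `stmt-CriticalPhenomena-4575` (`NoHeavyLowerTail`), seat `prim-l12-p1` gen 16 (`--supports stmt-CriticalPhenomena-4575`).
Memo `run/shared/lean/prim/prim-l12/FROM-prim-l12-p1-g16-SHARP-3PT.md` §2.

Bond percolation `μ = prodBernoulli w` with arbitrary pair weights on a finite vertex type `V`, two distinct vertices `a b`.  The conjectured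
SET form of the three-point variance row (memo §2, `(3PT-W)`; kernel-checked for `n ≤ 5` and `|W| ≤ 2`) reads, for a vertex set `W`,
`P(a↔b)·P(a↮b) ≤ P(a↔b, W ↮ {a,b}) + P(a↮b, W ↔ {a,b})`.  THIS FILE proves its TOP instance `W = V ∖ {a,b}` on every finite graph and for
all weights: with `Iso := {no open pair between {a,b} and V ∖ {a,b}}` (equivalently: no vertex outside `{a,b}` is joined to `a` or to `b`),

  `P(a↔b)·P(a↮b) ≤ P(a↔b, Iso) + P(a↮b, Isoᶜ)`.

Proof (elementary, [this work]): on `Iso`, `a ↔ b` iff the pair `s(a,b)` is open, so `P(a↔b, Iso) = p·π` and `P(a↮b, Iso) = (1−p)·π` with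
`p = w(s(a,b))`-probability of the direct pair and `π = P(Iso) = π_a π_b` (independence of disjoint coordinate sets); and `a ↮ b` whenever the direct
pair is closed and `a` or `b` has all its other pairs closed, so `P(a↮b) ≥ (1−p)(π_a + π_b − π_a π_b) ≥ (1−p)·√(π_a π_b)`; the claim is then the
real inequality `(1−θ)² ≥ π_a π_b (1 − 2p)`.

Main results: `not_reachable_of_isoA`, `openConn_inter_iso`, `threePointVarianceIsolation` (the displayed inequality),
`threePointVarianceIsolation_contact` (the same with `Isoᶜ` rewritten as "some vertex outside `{a,b}` is joined to `a` or `b`").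
-/

namespace Summit.CriticalPhenomena.PercolationContinuityZ3.Theorems.ThreePointVarianceIsolation

open MeasureTheory Set
open Literature.Probability.Percolation Literature.Probability.LatticeModels

variable {V : Type*} [Fintype V] [DecidableEq V]

/-! ## The boundary pairs of `{a,b}` and the isolation events -/

/-- The pairs `s(a,v)`, `v ∉ {a,b}`. [this work] -/
def bdry (a b : V) : Finset (Sym2 V) := ((Finset.univ.erase a).erase b).image fun v => s(a, v)

/-- Membership in `bdry`. [this work] -/
theorem mem_bdry {a b : V} {e : Sym2 V} : e ∈ bdry a b ↔ ∃ v, v ≠ a ∧ v ≠ b ∧ e = s(a, v) := by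
  simp only [bdry, Finset.mem_image, Finset.mem_erase, Finset.mem_univ, and_true]
  constructor
  · rintro ⟨v, ⟨hvb, hva⟩, rfl⟩; exact ⟨v, hva, hvb, rfl⟩
  · rintro ⟨v, hva, hvb, rfl⟩; exact ⟨v, ⟨hvb, hva⟩, rfl⟩

/-- `s(a,v) ∈ bdry a b` for `v ∉ {a,b}`. [this work] -/
theorem mk_mem_bdry {a b v : V} (hva : v ≠ a) (hvb : v ≠ b) : s(a, v) ∈ bdry a b :=
  mem_bdry.2 ⟨v, hva, hvb, rfl⟩

/-- The direct pair is not a boundary pair. [this work] -/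
theorem pair_not_mem_bdry {a b : V} : s(a, b) ∉ bdry a b := by
  intro h
  obtain ⟨v, hva, hvb, he⟩ := mem_bdry.1 h
  rcases Sym2.eq_iff.1 he with ⟨-, h2⟩ | ⟨h1, -⟩
  · exact hvb h2.symm
  · exact hva (h1 ▸ rfl)

/-- The direct pair is not a boundary pair of the other endpoint either. [this work] -/
theorem pair_not_mem_bdry' {a b : V} : s(a, b) ∉ bdry b a := by
  rw [Sym2.eq_swap]; exact pair_not_mem_bdry

/-- The two boundary sets are disjoint (for `a ≠ b`). [this work] -/
theorem disjoint_bdry {a b : V} (hab : a ≠ b) : Disjoint (bdry a b) (bdry b a) := by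
  rw [Finset.disjoint_left]
  intro e he he'
  obtain ⟨v, hva, hvb, rfl⟩ := mem_bdry.1 he
  obtain ⟨v', hv'b, hv'a, h⟩ := mem_bdry.1 he'
  rcases Sym2.eq_iff.1 h with ⟨h1, -⟩ | ⟨-, h2⟩
  · exact hab h1
  · exact hvb h2

/-- The event "all pairs `s(a,v)`, `v ∉ {a,b}`, are closed". [this work] -/
def isoA (a b : V) : Set (BondConfig V) := {ω | ∀ e ∈ bdry a b, e ∉ ω}

/-- The event "`{a,b}` has no open pair to the outside". [this work] -/
def iso (a b : V) : Set (BondConfig V) := isoA a b ∩ isoA b a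

/-- The event "the direct pair `s(a,b)` is open". [this work] -/
def pairOpen (a b : V) : Set (BondConfig V) := {ω | s(a, b) ∈ ω}

/-! ## Combinatorics: isolation decides `a ↔ b` by the direct pair -/

/-- If all pairs `s(a,v)`, `v ∉ {a,b}`, are closed and the direct pair is closed, then `a ↮ b`. [this work] -/
theorem not_reachable_of_isoA {a b : V} (hab : a ≠ b) {ω : BondConfig V} (hA : ω ∈ isoA a b) (hp : s(a, b) ∉ ω) :
    ¬ (openGraph ω).Reachable a b := by
  rintro ⟨p⟩
  cases p with
  | nil => exact hab rfl
  | @cons _ x _ hadj _ =>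
    rw [openGraph_adj] at hadj
    by_cases hxb : x = b
    · subst hxb; exact hp hadj.1
    · exact hA _ (mk_mem_bdry (Ne.symm hadj.2) hxb) hadj.1

/-- On `iso`, `a ↔ b` iff the direct pair is open. [this work] -/
theorem openConn_inter_iso {a b : V} (hab : a ≠ b) : openConn a b ∩ iso a b = pairOpen a b ∩ iso a b := by
  ext ω
  simp only [mem_inter_iff, openConn, iso, pairOpen, mem_setOf_eq]
  constructor
  · rintro ⟨h, hA, hB⟩
    refine ⟨?_, hA, hB⟩
    by_contra hp
    exact not_reachable_of_isoA hab hA hp h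
  · rintro ⟨h, hA, hB⟩
    exact ⟨SimpleGraph.Adj.reachable ((openGraph_adj ω a b).2 ⟨h, hab⟩), hA, hB⟩

/-- On `iso`, `a ↮ b` iff the direct pair is closed. [this work] -/
theorem openConn_compl_inter_iso {a b : V} (hab : a ≠ b) : (openConn a b)ᶜ ∩ iso a b = (pairOpen a b)ᶜ ∩ iso a b := by
  ext ω
  have h := Set.ext_iff.1 (openConn_inter_iso hab) ω
  simp only [mem_inter_iff, mem_compl_iff] at h ⊢
  tauto

/-- If the direct pair is closed and one endpoint has all its other pairs closed, then `a ↮ b`. [this work] -/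
theorem subset_openConn_compl {a b : V} (hab : a ≠ b) :
    (pairOpen a b)ᶜ ∩ (isoA a b ∪ isoA b a) ⊆ (openConn a b)ᶜ := by
  rintro ω ⟨hp, hA | hB⟩
  · exact not_reachable_of_isoA hab hA hp
  · intro h
    have hp' : s(b, a) ∉ ω := by rw [Sym2.eq_swap]; exact hp
    exact not_reachable_of_isoA (Ne.symm hab) hB hp' (SimpleGraph.Reachable.symm h)

/-! ## Probabilities -/

section prob
variable (w : Sym2 V → unitInterval) (a b : V)

/-- `isoA` is determined by the boundary pairs of `a`. [this work] -/
theorem determinedBy_isoA : DeterminedBy (isoA a b) (↑(bdry a b) : Set (Sym2 V)) := by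
  rw [determinedBy_iff]
  intro ω ω' h
  simp only [isoA, mem_setOf_eq]
  refine forall₂_congr fun e he => not_congr ?_
  constructor
  · intro h1
    have : e ∈ ω' ∩ ↑(bdry a b) := by rw [← h]; exact ⟨h1, he⟩
    exact this.1
  · intro h1
    have : e ∈ ω ∩ ↑(bdry a b) := by rw [h]; exact ⟨h1, he⟩
    exact this.1

omit [Fintype V] [DecidableEq V] in
/-- `pairOpen` is determined by the single coordinate `s(a,b)`. [this work] -/
theorem determinedBy_pairOpen : DeterminedBy (pairOpen a b) (↑({s(a, b)} : Finset (Sym2 V)) : Set (Sym2 V)) := by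
  rw [determinedBy_iff]
  intro ω ω' h
  rw [Finset.coe_singleton] at h
  simp only [pairOpen, mem_setOf_eq]
  constructor
  · intro h1
    have : s(a, b) ∈ ω' ∩ {s(a, b)} := by rw [← h]; exact ⟨h1, rfl⟩
    exact this.1
  · intro h1
    have : s(a, b) ∈ ω ∩ {s(a, b)} := by rw [h]; exact ⟨h1, rfl⟩
    exact this.1

omit [Fintype V] [DecidableEq V] in
/-- Its complement is determined by the same coordinate. [this work] -/
theorem determinedBy_pairOpen_compl : DeterminedBy (pairOpen a b)ᶜ (↑({s(a, b)} : Finset (Sym2 V)) : Set (Sym2 V)) := by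
  have h := determinedBy_pairOpen a b
  rw [determinedBy_iff] at h ⊢
  intro ω ω' hω
  rw [mem_compl_iff, mem_compl_iff, h ω ω' hω]

/-- `iso` is determined by the union of the two boundary sets. [this work] -/
theorem determinedBy_iso : DeterminedBy (iso a b) (↑(bdry a b ∪ bdry b a) : Set (Sym2 V)) := by
  refine DeterminedBy.inter ((determinedBy_isoA a b).mono ?_) ((determinedBy_isoA b a).mono ?_)
  · intro e he; exact Finset.mem_coe.2 (Finset.mem_union_left _ (Finset.mem_coe.1 he))
  · intro e he; exact Finset.mem_coe.2 (Finset.mem_union_right _ (Finset.mem_coe.1 he))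

/-- `P(isoA) = Π (1 - w)` over the boundary pairs of `a`. [this work] -/
theorem real_isoA : (prodBernoulli w).real (isoA a b) = ∏ e ∈ bdry a b, (1 - (w e : ℝ)) :=
  prodBernoulli_real_forall_notMem w (bdry a b)

omit [Fintype V] [DecidableEq V] in
/-- `P(pairOpen) = w(s(a,b))`. [this work] -/
theorem real_pairOpen : (prodBernoulli w).real (pairOpen a b) = w s(a, b) :=
  prodBernoulli_real_setOf_mem w s(a, b)

/-- `P(iso) = P(isoA a b) · P(isoA b a)` (disjoint boundary sets). [this work] -/
theorem real_iso (hab : a ≠ b) :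
    (prodBernoulli w).real (iso a b) = (prodBernoulli w).real (isoA a b) * (prodBernoulli w).real (isoA b a) :=
  prodBernoulli_real_inter_of_determinedBy_disjoint w (disjoint_bdry hab) (determinedBy_isoA a b) (determinedBy_isoA b a)
    MeasurableSet.of_discrete MeasurableSet.of_discrete

/-- The single coordinate `s(a,b)` is disjoint from both boundary sets. [this work] -/
theorem disjoint_pair_bdry : Disjoint ({s(a, b)} : Finset (Sym2 V)) (bdry a b ∪ bdry b a) := by
  rw [Finset.disjoint_singleton_left, Finset.mem_union, not_or]
  exact ⟨pair_not_mem_bdry, pair_not_mem_bdry'⟩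

/-- `P(pairOpen ∩ iso) = P(pairOpen) P(iso)`. [this work] -/
theorem real_pairOpen_inter_iso :
    (prodBernoulli w).real (pairOpen a b ∩ iso a b) = (prodBernoulli w).real (pairOpen a b) * (prodBernoulli w).real (iso a b) :=
  prodBernoulli_real_inter_of_determinedBy_disjoint w (disjoint_pair_bdry a b) (determinedBy_pairOpen a b) (determinedBy_iso a b)
    MeasurableSet.of_discrete MeasurableSet.of_discrete

/-- `P(pairOpenᶜ ∩ iso) = P(pairOpenᶜ) P(iso)`. [this work] -/
theorem real_pairOpen_compl_inter_iso :
    (prodBernoulli w).real ((pairOpen a b)ᶜ ∩ iso a b) = (prodBernoulli w).real (pairOpen a b)ᶜ * (prodBernoulli w).real (iso a b) :=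
  prodBernoulli_real_inter_of_determinedBy_disjoint w (disjoint_pair_bdry a b) (determinedBy_pairOpen_compl a b) (determinedBy_iso a b)
    MeasurableSet.of_discrete MeasurableSet.of_discrete

/-- `P(pairOpenᶜ ∩ (isoA a b ∪ isoA b a)) = P(pairOpenᶜ) P(isoA a b ∪ isoA b a)`. [this work] -/
theorem real_pairOpen_compl_inter_union :
    (prodBernoulli w).real ((pairOpen a b)ᶜ ∩ (isoA a b ∪ isoA b a)) =
      (prodBernoulli w).real (pairOpen a b)ᶜ * (prodBernoulli w).real (isoA a b ∪ isoA b a) := by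
  refine prodBernoulli_real_inter_of_determinedBy_disjoint w (disjoint_pair_bdry a b) (determinedBy_pairOpen_compl a b) ?_
    MeasurableSet.of_discrete MeasurableSet.of_discrete
  have hA := (determinedBy_isoA a b).mono (F' := (↑(bdry a b ∪ bdry b a) : Set (Sym2 V)))
    (by intro e he; exact Finset.mem_coe.2 (Finset.mem_union_left _ (Finset.mem_coe.1 he)))
  have hB := (determinedBy_isoA b a).mono (F' := (↑(bdry a b ∪ bdry b a) : Set (Sym2 V)))
    (by intro e he; exact Finset.mem_coe.2 (Finset.mem_union_right _ (Finset.mem_coe.1 he)))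
  rw [determinedBy_iff] at hA hB ⊢
  intro ω ω' h
  rw [mem_union, mem_union, hA ω ω' h, hB ω ω' h]

end prob

/-! ## The theorem -/

/-- **Isolation form of the three-point variance row, every finite weighted graph**: for `a ≠ b`,
`P(a↔b)·P(a↮b) ≤ P(a↔b, {a,b} has no open pair to the outside) + P(a↮b, {a,b} has an open pair to the outside)`. [this work] -/
theorem threePointVarianceIsolation (w : Sym2 V → unitInterval) {a b : V} (hab : a ≠ b) :
    (prodBernoulli w).real (openConn a b) * (prodBernoulli w).real (openConn a b)ᶜ ≤
      (prodBernoulli w).real (openConn a b ∩ iso a b) + (prodBernoulli w).real ((openConn a b)ᶜ ∩ (iso a b)ᶜ) := by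
  set μ := prodBernoulli w with hμ
  -- names for the five numbers
  set θ := μ.real (openConn a b) with hθ
  set p := μ.real (pairOpen a b) with hp
  set πa := μ.real (isoA a b) with hπa
  set πb := μ.real (isoA b a) with hπb
  have hθc : μ.real (openConn a b)ᶜ = 1 - θ := probReal_compl_eq_one_sub MeasurableSet.of_discrete
  have hpc : μ.real (pairOpen a b)ᶜ = 1 - p := probReal_compl_eq_one_sub MeasurableSet.of_discrete
  have hiso : μ.real (iso a b) = πa * πb := real_iso w a b hab
  -- (1) P(conn ∩ iso) = p πa πb
  have h1 : μ.real (openConn a b ∩ iso a b) = p * (πa * πb) := by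
    rw [openConn_inter_iso hab, real_pairOpen_inter_iso, hiso]
  -- (2) P(connᶜ ∩ isoᶜ) = (1 - θ) - (1 - p) πa πb
  have h2 : μ.real ((openConn a b)ᶜ ∩ (iso a b)ᶜ) = (1 - θ) - (1 - p) * (πa * πb) := by
    have hsplit := measureReal_inter_add_sdiff (μ := μ) (s := (openConn a b)ᶜ) (t := iso a b) MeasurableSet.of_discrete
    rw [openConn_compl_inter_iso hab, real_pairOpen_compl_inter_iso, hpc, hiso, hθc, Set.sdiff_eq] at hsplit
    linarith
  -- (3) 1 - θ ≥ (1 - p)(πa + πb - πa πb)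
  have hunion : μ.real (isoA a b ∪ isoA b a) = πa + πb - πa * πb := by
    have hu := measureReal_union_add_inter (μ := μ) (s := isoA a b) (t := isoA b a) MeasurableSet.of_discrete
    have hi : μ.real (isoA a b ∩ isoA b a) = πa * πb := hiso
    rw [hi] at hu
    linarith
  have h3 : (1 - p) * (πa + πb - πa * πb) ≤ 1 - θ := by
    rw [← hθc, ← hunion, ← hpc, ← real_pairOpen_compl_inter_union]
    exact measureReal_mono (subset_openConn_compl hab)
  -- ranges
  have hp0 : 0 ≤ p := measureReal_nonneg
  have hp1 : p ≤ 1 := measureReal_le_one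
  have hπa0 : 0 ≤ πa := measureReal_nonneg
  have hπa1 : πa ≤ 1 := measureReal_le_one
  have hπb0 : 0 ≤ πb := measureReal_nonneg
  have hπb1 : πb ≤ 1 := measureReal_le_one
  have hθ0 : 0 ≤ θ := measureReal_nonneg
  have hθ1 : θ ≤ 1 := measureReal_le_one
  rw [hθc, h1, h2]
  -- goal: θ(1-θ) ≤ p πa πb + (1-θ) - (1-p) πa πb, i.e. (1-θ)² ≥ πa πb (1 - 2p)
  have hg : πa * πb ≤ (πa + πb - πa * πb) ^ 2 := by
    have hga : πa ≤ πa + πb - πa * πb := by nlinarith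
    have hgb : πb ≤ πa + πb - πa * πb := by nlinarith
    calc πa * πb ≤ (πa + πb - πa * πb) * (πa + πb - πa * πb) := mul_le_mul hga hgb hπb0 (le_trans hπa0 hga)
      _ = (πa + πb - πa * πb) ^ 2 := by ring
  rcases le_or_gt (1 - 2 * p) 0 with hq | hq
  · nlinarith [mul_nonneg hπa0 hπb0]
  · have hg0 : 0 ≤ πa + πb - πa * πb := by nlinarith
    have hy : (1 - p) * (πa + πb - πa * πb) ≤ 1 - θ := h3
    have hy0 : 0 ≤ (1 - p) * (πa + πb - πa * πb) := mul_nonneg (by linarith) hg0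
    have hsq : ((1 - p) * (πa + πb - πa * πb)) ^ 2 ≤ (1 - θ) ^ 2 := by
      exact pow_le_pow_left₀ hy0 hy 2
    have hkey : πa * πb * (1 - 2 * p) ≤ (1 - θ) ^ 2 := by
      calc πa * πb * (1 - 2 * p) ≤ (πa + πb - πa * πb) ^ 2 * (1 - p) ^ 2 := by
            apply mul_le_mul hg (by nlinarith) (le_of_lt hq) (sq_nonneg _)
        _ = ((1 - p) * (πa + πb - πa * πb)) ^ 2 := by ring
        _ ≤ (1 - θ) ^ 2 := hsq
    nlinarith

/-- `isoᶜ` is the event that some vertex outside `{a,b}` is joined (by an open path) to `a` or to `b`. [this work] -/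
theorem iso_compl_eq {a b : V} (hab : a ≠ b) :
    (iso a b)ᶜ = {ω : BondConfig V | ∃ v, v ≠ a ∧ v ≠ b ∧ ((openGraph ω).Reachable a v ∨ (openGraph ω).Reachable b v)} := by
  ext ω
  simp only [mem_compl_iff, iso, isoA, mem_inter_iff, mem_setOf_eq, not_and_or, not_forall, not_not, exists_prop]
  constructor
  · rintro (⟨e, he, heω⟩ | ⟨e, he, heω⟩)
    · obtain ⟨v, hva, hvb, rfl⟩ := mem_bdry.1 he
      exact ⟨v, hva, hvb, Or.inl (SimpleGraph.Adj.reachable ((openGraph_adj ω a v).2 ⟨heω, Ne.symm hva⟩))⟩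
    · obtain ⟨v, hvb, hva, rfl⟩ := mem_bdry.1 he
      exact ⟨v, hva, hvb, Or.inr (SimpleGraph.Adj.reachable ((openGraph_adj ω b v).2 ⟨heω, Ne.symm hvb⟩))⟩
  · rintro ⟨v, hva, hvb, hr⟩
    -- a walk from {a,b} to v ∉ {a,b} has a boundary dart
    by_contra hcon
    rw [not_or, not_exists, not_exists] at hcon
    obtain ⟨hA, hB⟩ := hcon
    have hA' : ∀ e ∈ bdry a b, e ∉ ω := fun e he => by
      have := hA e; tauto
    have hB' : ∀ e ∈ bdry b a, e ∉ ω := fun e he => by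
      have := hB e; tauto
    have key : ∀ u, (u = a ∨ u = b) → (openGraph ω).Reachable u v → False := by
      intro u hu ⟨q⟩
      obtain ⟨d, -, hd1, hd2⟩ := q.exists_boundary_dart ({a, b} : Set V) (by rcases hu with rfl | rfl <;> simp) (by
        simp only [mem_insert_iff, mem_singleton_iff, not_or]; exact ⟨hva, hvb⟩)
      have hadj := (openGraph_adj ω d.fst d.snd).1 d.adj
      simp only [mem_insert_iff, mem_singleton_iff, not_or] at hd1 hd2
      rcases hd1 with h1 | h1
      · exact hA' _ (mk_mem_bdry hd2.1 hd2.2) (h1 ▸ hadj.1)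
      · exact hB' _ (mk_mem_bdry hd2.2 hd2.1) (h1 ▸ hadj.1)
    rcases hr with h | h
    · exact key a (Or.inl rfl) h
    · exact key b (Or.inr rfl) h

/-- **Contact form** (`W = V ∖ {a,b}` in the set version of the three-point variance row): for `a ≠ b`,
`P(a↔b)·P(a↮b) ≤ P(a↔b, no outside vertex joined to a or b) + P(a↮b, some outside vertex joined to a or b)`. [this work] -/
theorem threePointVarianceIsolation_contact (w : Sym2 V → unitInterval) {a b : V} (hab : a ≠ b) :
    (prodBernoulli w).real (openConn a b) * (prodBernoulli w).real (openConn a b)ᶜ ≤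
      (prodBernoulli w).real (openConn a b ∩ {ω | ∃ v, v ≠ a ∧ v ≠ b ∧ ((openGraph ω).Reachable a v ∨ (openGraph ω).Reachable b v)}ᶜ) +
        (prodBernoulli w).real ((openConn a b)ᶜ ∩ {ω | ∃ v, v ≠ a ∧ v ≠ b ∧ ((openGraph ω).Reachable a v ∨ (openGraph ω).Reachable b v)}) := by
  have h := threePointVarianceIsolation w hab
  rw [← iso_compl_eq hab, compl_compl]
  exact h

end Summit.CriticalPhenomena.PercolationContinuityZ3.Theorems.ThreePointVarianceIsolation
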